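import Summits.HodgeConjecture.HodgeConjecture.Theorems.Ring2HypothesesDescentMotivatedKunneth
import Summits.HodgeConjecture.HodgeConjecture.Theorems.Ring2HypothesesDescentLefschetzProjectionsAlgebraic
import HarnessLib

/-!
# Ring 2 hypotheses, descent face — the Lefschetz projections `p_{(i,t)}` as SINGLE correspondence classes (zero on the
# other degrees): motivated for every `X`, algebraic under `B(X)`

research route conditional on HC_CM; not a corollary; Q11.4-sentence-2 already refuted in dim ≥ 3.
Cell `pub-hodge-ring2` (Hodge ladder STAGE 3), seat `ring2-b05` (binder row b05
`Ring2.Hypotheses.MotivatedImpliesAlgebraicAV`), gen 36. `HC_CM` (`Theses.RankFourFaces.CMAbelianHodge`) does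
not occur in this file; nothing here proves a case of the Hodge conjecture; rows b05 / b10 stay OPEN.

André 1996 Prop. 2.2 lists the operators `p^…` (projections of the Lefschetz decomposition) among those «donnés par des
correspondances motivées»; Kleiman 1968 §1.4 writes them `p^{i,j}`. Gen 36 proved that each projection
`π_{(i,t)} : Hᵃ → Lᵗ Pⁱ ⊆ Hᵃ` is induced ON `Hᵃ` by a motivated class (`internalProj_lefschetzSummand_mem_map_corrAction`, with
unspecified action on the other degrees) and that the Künneth projector `π^a` is ONE motivated class
(`exists_motivated_kunnethProjector`). Composing the two (uniformly, `exists_corrCompClass_total`) gives ONE class of codimension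
`n` acting as `π_{(i,t)}` on `Hᵃ` and as `0` on every other degree — the honest «`p`-operator as a correspondence»:

* `exists_motivated_lefschetzProjectorClass` — motivated, for every smooth projective complex `X` and polarisation `η`;
* `exists_algebraic_lefschetzProjectorClass_of_standardConjectureBStar` — algebraic under `StandardConjectureBStar n X η`
  (`isAlgebraicCorrespondence_internalProj_of_standardConjectureBStar` + `B ⟹ C`).

No definition, no named fact, no sorry. References: Andre1996Motifs (Prop. 2.2 p. 16), Kleiman1968AlgebraicCycles (§1.4 Prop.
1.4.4), VoisinHodgeI2002 (§6.2.3 Cor. 6.26).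
-/

noncomputable section

-- every declaration of this problem lives in `Summit.HodgeConjecture.HodgeConjecture.…` (summit = sub-problem)
set_option linter.dupNamespace false

open CategoryTheory AlgebraicGeometry MonoidalCategory CartesianMonoidalCategory
open Literature.AlgebraicTopology.SingularHomology Literature.Geometry.Kaehler
open Literature.AlgebraicGeometry Literature.AlgebraicGeometry.Motives
  Literature.AlgebraicGeometry.HodgeTheory

namespace Summit.HodgeConjecture.HodgeConjecture.Theorems

variable {n : ℕ} {X : SchemeOver ℂ} {η : complexBetti X 2}

/-- **The Lefschetz projection `π_{(i,t)}` of degree `a` as ONE motivated class**: for `X` smooth projective of dimension `n`, a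
polarisation class `η`, an orientation family `μ`, a degree `a` and a Lefschetz index `P = (i, t)` (`i + 2t = a`), there is a
MOTIVATED `u ∈ A_motⁿ(X ⊗ X)_ℂ` with `[u]_* = π_P` on `Hᵃ(X(ℂ))` and `[u]_* = 0` on `H^{a'}(X(ℂ))` for every `a' ≠ a`
(`u = u_P ∘ π^a`). [cite: Andre1996Motifs, Prop. 2.2 (p. 16)] [cite: Kleiman1968AlgebraicCycles, §1.4 Prop. 1.4.4] -/
theorem exists_motivated_lefschetzProjectorClass (μ : OrientationFamily) (hX : IsSmoothProjective n X)
    (hη : IsPolarizationClass n X η) (a : ℕ) (P : {p : ℕ × ℕ // p.1 + 2 * p.2 = a}) :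
    ∃ u ∈ motivatedClasses (n + n) (X ⊗ X) n,
      corrAction μ hX hX (rfl : a + 2 * n = a + 2 * n) u =
        internalProj (isInternal_lefschetzSummand η n hη.hasHardLefschetz (fun _ hm ↦ subsingleton_complexBetti hX hm) a) P ∧
      ∀ a' : ℕ, a' ≠ a → corrAction μ hX hX (rfl : a' + 2 * n = a' + 2 * n) u = 0 := by
  obtain ⟨uP, huP, hact⟩ := internalProj_lefschetzSummand_mem_map_corrAction μ hX hη a P
  obtain ⟨π, hπ, hπact⟩ := exists_motivated_kunnethProjector μ hX a
  obtain ⟨u, hmot, -, hu⟩ := exists_corrCompClass_total μ hX hX hX (rfl : n + n = n + n) uP π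
  refine ⟨u, hmot huP hπ, ?_, fun a' ha' ↦ ?_⟩
  · rw [hu rfl rfl rfl, hπact a, if_pos rfl, LinearMap.comp_id, hact]
  · rw [hu rfl rfl rfl, hπact a', if_neg ha', LinearMap.comp_zero]

/-- **Under `B(X)` the Lefschetz projection `π_{(i,t)}` is ONE algebraic class** (zero on the other degrees): for
`StandardConjectureBStar n X η`, `a ≤ 2n` and a Lefschetz index `P` of degree `a`, there is `u ∈ Nⁿ H²ⁿ((X ⊗ X)(ℂ))`
algebraic with `[u]_* = π_P` on `Hᵃ` and `[u]_* = 0` on `H^{a'}`, `a' ≠ a` (complex orientation family): Kleiman's clause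
(`isAlgebraicCorrespondence_internalProj_of_standardConjectureBStar`) composed with the algebraic Künneth projector (`B ⟹ C`).
[cite: Kleiman1968AlgebraicCycles, §1.4 Prop. 1.4.4 and §2] [cite: Andre1996Motifs, Prop. 1.2 (p. 11)] -/
theorem exists_algebraic_lefschetzProjectorClass_of_standardConjectureBStar (hX : IsSmoothProjective n X)
    (hη : IsPolarizationClass n X η) (hB : StandardConjectureBStar n X η) {a : ℕ} (ha : a ≤ 2 * n)
    (P : {p : ℕ × ℕ // p.1 + 2 * p.2 = a}) :
    ∃ u ∈ algebraicClasses (X ⊗ X) n,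
      corrAction complexOrientationFamily hX hX (rfl : a + 2 * n = a + 2 * n) u =
        internalProj (isInternal_lefschetzSummand η n hη.hasHardLefschetz (fun _ hm ↦ subsingleton_complexBetti hX hm) a) P ∧
      ∀ a' : ℕ, a' ≠ a → corrAction complexOrientationFamily hX hX (rfl : a' + 2 * n = a' + 2 * n) u = 0 := by
  obtain ⟨e, hab, uP, huP, hact⟩ := Ring2.AbelianAll.IsAlgebraicCorrespondence.exists_eq_corrAction hX hX
    (isAlgebraicCorrespondence_internalProj_of_standardConjectureBStar hX hη hB ha P)
  obtain rfl : n = e := by omega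
  obtain ⟨π, hπ, hπact⟩ := exists_algebraic_kunnethProjector_of_standardConjectureBStar hX hη hB a
  obtain ⟨u, -, halg, hu⟩ := exists_corrCompClass_total complexOrientationFamily hX hX hX (rfl : n + n = n + n) uP π
  refine ⟨u, halg huP hπ, ?_, fun a' ha' ↦ ?_⟩
  · rw [hu rfl rfl rfl, hπact a, if_pos rfl, LinearMap.comp_id, ← hact]
  · rw [hu rfl rfl rfl, hπact a', if_neg ha', LinearMap.comp_zero]

end Summit.HodgeConjecture.HodgeConjecture.Theorems

end
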